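import Mathlib
import HarnessLib
import HarnessLib.Audit
import Summits.ResolutionOfSingularities.Statement
import HarnessLib.Audit.Status.Attr

/-!
Route: FoliationDescent

# Route FoliationDescent — wild = additive — uniformize the p-closed vector field on the regular
Frobenius top, then descend

It suffices to show X = FolLU ∧ LogCanQuotLU ∧ DualSandwich together with the perfect-field steering
chain shared VERBATIM with routes
ShadowGame / WildCones / FrobeniusClosing (TorsorToLurelPerfect stmt-16162, PatchingRelPerfect
stmt-16161, DescentPerfectToAll stmt-0549; target
TorsorLUPerfect stmt-16158 = Valuative's LuAlphaPTorsor 0641 over perfect k). FolLU (crux 2, the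
TRANSFERRED ENGINE): along any valuation ring O
of K/k (k perfect, char p), a f.g. model S regular at the centre and a nonzero p-closed k-derivation
D of K (= a rank-ONE 1-foliation on the regular
top) admit a further f.g. model S ≤ S' ≤ O, STILL REGULAR at the centre, on whose local ring a
rescaling g•D is LOG-CANONICAL: NON-SINGULAR (some
value is a unit) or MULTIPLICATIVE ((g•D)^p = u·(g•D) with u a unit). LogCanQuotLU (crux 3): the
constants K^D of such a pair have a f.g. model inside
O, regular at the centre (non-singular ⇒ constants regular; multiplicative ⇒ μ_p-toric quotient,
uniformized torically). DualSandwich (crux 4, the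
consumed reduction): FolLU → LogCanQuotLU → TorsorLUPerfect by the DOUBLE SANDWICH K₀(t) ⊆ K₀^(1/p)
⊇ A₀^(1/p) and n−1 degree-p DESCENTS.
Card realised: alpha-p-to-mu-p-foliation-reduction (spine: its B1-loc/B2, made valuative, typed, and
re-assembled by descent instead of Picover + Pialt);
card sos-shadow-weighted-blowup (weights at additive points) is an adjacent ARM, not realised here
(FolLU asks for schematic regular models).
Lean: `FolLU ∧ LogCanQuotLU ∧ DualSandwich ∧ TorsorToLurelPerfect ∧ PatchingRelPerfect ∧
DescentPerfectToAll`

## Assembly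
Pure logic, certified sorry-free (Sketch.lean = glue.lean: lean check rc 0, 0 sorries, `closes`
axioms propext · Classical.choice · Quot.sound):
DualSandwich applied to FolLU and LogCanQuotLU gives the target TorsorLUPerfect; at a prime p,
TorsorToLurelPerfect turns its body into relative LU over
perfect k, PatchingRelPerfect into resolution of every reduced separated finite-type scheme over
every perfect field of char p, DescentPerfectToAll into
ResolutionInChar p; the summit is ∀ p prime, ResolutionInChar p by definition: `closes hF hQ hR hT
hP hD := fun p hp => hD p hp (hP p hp (hT p hp ((hR hF hQ) p hp)))`.
The route file needs only Mathlib and the Statement (no Literature module carrying an unproved fact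
enters the cone); the four shared decls are byte-identical
to ShadowGame's (checked by diff this session), so dedup attaches this route to
stmt-16158/16162/16161/0549.

Rationale: WHY THIS LINE. Operator ADJACENT TRANSFER. Solved adjacent cases: resolution of p-closed vector
fields on SURFACES (Rudakov–Shafarevich doi:10.1070/im1976v010n06abeh001833
Thm 1; Giraud 1983 normal form ⇒ Posva arXiv:2405.05735 Thm 1/4.0.1, functorial; Hirokado
doi:10.1215/kjm/1250517864 for p = 2) and, in characteristic 0,
reduction of LINE foliations in dimension 3 (Seidenberg doi:10.2307/2373435; Cano
doi:10.4007/annals.2004.160.907; McQuillan–Panazzolo doi:10.4310/jdg/1376053448;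
VALUATIVE log-elementary reduction with smooth centres, Cano–Roche–Spivakovsky
doi:10.1007/s13398-013-0117-7). Dictionary (Jacobson–Ekedahl duality,
doi:10.1090/pspum/046.2/927978; Miyanishi–Ito isbn:9789811215209 §1.8): the atom 'uniformize the
cover t^p = a ABOVE a regular base A₀' (0641/16158) becomes,
after the reverse Frobenius sandwich K₀(t) ⊆ K₀^(1/p), 'uniformize the QUOTIENT of the REGULAR top S
= A₀^(1/p) by ONE p-closed derivation' — cleaning
a ↦ a + b^p becomes invisible (the strict transform of a vector field is canonical), the order of a
becomes (ord D, Jordan type of the linear part,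
ord λ in D^p = λD), the tame endpoint becomes a MULTIPLICATIVE point (μ_p-type, linearly reductive,
toric quotient: Posva arXiv:2311.16694 Thm 7 /
Prop 11–12, Aramova–Avramov doi:10.1007/bf01472134), and p-closedness kills exactly the char-0
terminal forms that are not linearisable (non-F_p
eigenvalue ratios, saddle-nodes; McQuillan's remark quoted in arXiv:2405.05735 p.4). WHAT BREAKS:
Posva's char-p proofs DEDUCE the foliation statement
from Giraud/Cossart normal forms of functions mod p-th powers (dimension-specific, arXiv:2405.05735
p.2), and for RANK one in dimension 3 he must leave
μ_p-quotient singularities on the ambient (arXiv:2311.16694 Thm 7, 'unclear whether we may assume X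
regular'); char-0 valuative reduction of line
foliations is open from dimension 4 (frontier: arXiv:2503.00926). THE REPAIR CRUX is FolLU:
valuative log-canonical reduction of a p-closed vector field
keeping the top regular, in all dimensions. No listed route works on the derivation side:
RadicialJung cleans the exact differential da on the BASE
(corank one, assembling through Pialt); ShadowGame / WildCones / FrobeniusClosing drive the EQUATION
z^p = a under point blow-ups; Valuative / CyclicCovers
ASCEND. Imported area: birational geometry of foliations (char 0 and p), restricted Lie algebras /
purely inseparable Galois theory.

RANKED CRUXES. #0 TorsorLUPerfect (target) — local uniformization of α_p-torsors t^p = a over bases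
regular at the centre, over PERFECT ground fields (shared verbatim, stmt-16158 = Valuative's 0641
with [PerfectField k]); derived in `closes` as DualSandwich applied to FolLU and LogCanQuotLU. (why
it might fail: it is Temkin2013 Rem 1.3.5's residual problem, open in dim ≥ 4 for every p
(CutkoskyMourtada2019 §1); fails iff LU fails over some perfect field.) [Temkin2013,
arXiv:0804.1554, CutkoskyMourtada2019,
Literature.Barriers.ResolutionOfSingularities.DimensionFourFrontier]
#2 FolLU (crux) — FOLIATION LOCAL UNIFORMIZATION (card alpha-p-to-mu-p B1-loc, typed): k perfect of
char p, O a valuation ring of K ⊇ k, S ≤ O a f.g. k-subalgebra with Frac S = K, regular at the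
centre, D a nonzero k-derivation of K with D^p = c·D (rank-one 1-foliation). Then some f.g. S' with
S ≤ S' ≤ O, Frac S' = K, REGULAR at the centre, and some g ≠ 0 such that g•D maps the local ring
S'_c into itself and is there NON-SINGULAR (∃ x ∈ S'_c with (g•D)x a unit) or MULTIPLICATIVE (∃ unit
u of S'_c with (g•D)^p = u·(g•D)). Expected mechanism: blow up regular D-invariant centres inside
Sing(D) along O; counter = (ord D, Jordan type of the nilpotent linear part, ord λ); additive →
multiplicative by Hochschild's formula for λ under u·π^*D. [difficulty: open-problem] (why it might
fail: known only in dim 2 (Posva 2405.05735 Thm 1; RS76); rank one in dim 3 char p needs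
μ_p-quotient ambient points in print (2311.16694 Thm 7); char-0 analogue open in dim ≥ 4; an
additive point reproducing its (ord D, Jordan type, ord λ) along a valuation kills the counter.)
[arXiv:2405.05735, arXiv:2311.16694, doi:10.1070/im1976v010n06abeh001833,
doi:10.1007/s13398-013-0117-7, doi:10.4310/jdg/1376053448, arXiv:2503.00926]
#3 LogCanQuotLU (crux) — LOG-CANONICAL QUOTIENTS UNIFORMIZE (card alpha-p-to-mu-p B2, valuative): in
the output situation of FolLU (S' regular at the centre, g•D preserving S'_c, non-singular or
multiplicative, D ≠ 0 p-closed) and for every f.g. R ≤ S' of D-constants, there is a f.g.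
k-subalgebra A ≤ O of constants (D = 0 on A) with R ≤ A, Frac A = K^D and A regular at the centre.
Non-singular case: A := S' ∩ K^D works (finite over k[S'^p]; (S' ∩ K^D)_c = (S'_c)^D; rescale to ∂x
= 1, ∂^p = 0, Taylor projection S'_c = ⊕_(i<p) (S'_c)^D x^i, faithfully flat descent of regularity —
RS76 Thm 1 / Aramova–Avramov / Miyanishi–Ito §1.8.2 Lemma (4)). Multiplicative case: (S'_c)^D is
étale-locally the μ_p-quotient k'[[x]]^(Σλ_i x_i ∂_i) (Rudakov–Shafarevich normal form; Posva
2311.16694 Prop 11–12/Thm 7), a diagonalizable-group quotient, hence toric and uniformizable by a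
toric local blow-up inside K^D. [deps: FolLU] [difficulty: L] (why it might fail: the multiplicative
normal form is printed at CLOSED points over algebraically closed k (formal coordinates); at
non-closed centres / perfect non-closed k one needs a Zariski-local (étale-descended) toric
uniformization of the constants and control of constants under henselization.) [arXiv:2311.16694,
doi:10.1070/im1976v010n06abeh001833, doi:10.1007/bf01472134, isbn:9789811215209, arXiv:1412.7941]
#4 DualSandwich (crux) — THE DOUBLE SANDWICH (consumed reduction, per the whole statements): FolLU →
LogCanQuotLU → TorsorLUPerfect. Given A₀ ≤ O regular at the centre over PERFECT k, t^p = a ∈ A₀, K =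
K₀(t): put K' := K₀^(1/p) ⊇ K with the unique extension O' of O, S := A₀^(1/p) (≅ A₀ by Frobenius;
finitely generated over k BECAUSE k is perfect; regular at the centre of O'), R := A₀[t] ⊆ S ∩ K;
[K' : K] = p^(n−1); choose a maximal chain K = F₀ ⊂ F₁ ⊂ … ⊂ F_(n−1) = K' of degree-p steps; each
F_(i+1)/F_i is the kernel extension of a p-closed derivation d/dz (z^p ∈ F_i), so FolLU then
LogCanQuotLU (same R, valuation ring O' ∩ F_i) produce a regular f.g. model of F_i containing R from
one of F_(i+1); after n−1 steps A ⊇ A₀[t] in O, Frac A = K, regular at the centre. (The converse,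
0641 ⇒ the bare descent step, is the usual upward sandwich: recorded in the header, not an item.)
[deps: FolLU, LogCanQuotLU] [difficulty: M] (why it might fail: elementary but unformalized: k
perfect (A₀^(1/p) f.g.), degree-p chains in a finite purely inseparable extension, transport of
valuation rings/centres through Frobenius and inclusions; a 'regular at the centre' mismatch between
O' on S and O on A₀ would force a restatement.) [Temkin2013, arXiv:0804.1554,
doi:10.1090/pspum/046.2/927978, isbn:9789811215209]
#5 TorsorToLurelPerfect (crux) — Temkin's inseparable reduction over PERFECT ground fields (shared
verbatim, stmt-16162): TorsorLUPerfect at p ⇒ relative LU for every f.g. K/k, k perfect of char p.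
[deps: DualSandwich] [difficulty: L] (why it might fail: rests on Temkin2013 Thm 1.3.2 (vendored
fact with an unproved leaf in tree: Temkin2013RelativeCurveSmoothFibre) and on Temkin's model
dominating the GIVEN R; smooth ≠ regular bookkeeping at each tower step.) [Temkin2013,
arXiv:0804.1554, Literature.AlgebraicGeometry.Resolution.Temkin2013Relative,
Literature.Barriers.ResolutionOfSingularities.InseparableBaseChange]
#6 PatchingRelPerfect (crux) — Zariski patching over PERFECT ground fields (shared verbatim,
stmt-16161): relative LU for all f.g. K/k, k perfect of char p ⇒ every reduced separated finite-type
scheme over every perfect field of char p has a resolution. [deps: TorsorToLurelPerfect]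
[difficulty: open-problem] (why it might fail: patching LUs into one proper regular model is known
only in dim ≤ 3 (Zariski; CossartPiltant2008 Prop 4.9 / Piltant2013); in dim ≥ 4 no reduction Res ⇐
LU exists even in char 0 (CutkoskyMourtada2019 p.3); plain relative LU may be too weak an input.)
[CutkoskyMourtada2019, Temkin2013, CossartPiltant2019, NovacoskiSpivakovsky2014,
Literature.Barriers.ResolutionOfSingularities.DimensionFourFrontier]
#7 DescentPerfectToAll (crux) — perfect fields ⇒ all fields of characteristic p (shared verbatim,
stmt-0549). [deps: PatchingRelPerfect] [difficulty: L] (why it might fail: only known mechanism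
spreads X over a f.g. field of definition and base-changes a resolution over a perfect subfield
back; regular is not geometrically regular under inseparable extension (EGA IV 6.7.4), e.g. k =
F_p((t)).) [arXiv:math/0703678, Kollar2007,
Literature.Barriers.ResolutionOfSingularities.InseparableBaseChange,
Literature.Barriers.ResolutionOfSingularities.RegularNotGeometricallyRegular]

TWO-LAYER PLAN. Foreseen glued splits (nothing filed now; k ≤ 3, depth 1): FolLU ⇐ AdditiveExit
(along O, finitely many blow-ups of regular D-invariant centres inside
Sing(D) leave no ADDITIVE singular point at the centre — the counter (ord D, Jordan type, ord λ)
drops) → InvariantCentreRegularity (the worst stratum of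
the counter contains a regular D-invariant centre through the centre of O, or a finer regular
invariant sub-centre does) → FolLU; LogCanQuotLU ⇐ NonSingQuot
(provable now: Taylor projection + faithfully flat descent) → MultQuotToric (étale-local diagonal
normal form + Zariski-local toric uniformization of the
constants) → LogCanQuotLU; DualSandwich ⇐ FrobeniusTop (K ⊆ K₀^(1/p), S := A₀^(1/p) f.g. and regular
at the centre of O') → DegreePChain (maximal chains
of a finite purely inseparable extension have degree-p steps, each the kernel extension of a
p-closed derivation) → DualSandwich.

KILL CRITERIA. ¬FolLU (a valuation of a function field of dimension ≥ 3 over a perfect field and a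
p-closed derivation on a regular local model that admits NO regular
local blow-up sequence along the valuation ending log-canonical) closes the route `refuted:FolLU`
WITHOUT deciding the summit (FolLU is stronger than LU:
it keeps the top regular) — hand the witness to card alpha-p-to-mu-p-foliation-reduction as its
answer. LogCanQuotLU refuted-misstated (e.g. the
multiplicative clause admits a non-toric quotient at a non-closed centre) ⇒ restate with the printed
normal-form hypothesis (new decl LogCanQuotLUR) and
re-certify `closes`; refuted-substantive ⇒ close. DualSandwich is provable now; a refutation means a
typing slip ⇒ restate. TorsorLUPerfect proved by ANY
route (ShadowGame, WildCones, FrobeniusClosing, Valuative's 0641) moots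
FolLU/LogCanQuotLU/DualSandwich as a path to the summit (the route then survives
only as the foliation theorem); PatchingRelPerfect refuted ⇒ every Frame-I route, this one included,
pivots to the Picover assembly (card B1 ⇒ Picover +
Pialt) or to the fixed-locus assembly of card mu-p-fixed-locus-universality.

NOT DECOMPOSED YET. The counter and the centre-choice rule inside FolLU (layer-2 children above);
the global (projective, all points at once) version B1 of the card and its
Picover assembly through Posva's B2 + Bergh–Rydh destackification (a different route if ever wanted:
it needs Pialt); weighted centres at additive points
(card sos-shadow-weighted-blowup) and DM-stack ambients (Posva Thm 2) — deliberately excluded: FolLU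
asks for SCHEMATIC regular models, which is what
the valuative frame consumes; the all-fields version (imperfect k: A₀^(1/p) is not f.g.) is
delegated to DescentPerfectToAll.

CHEAPEST FALSIFIER. Run by hand this session (passes): the Cossart–Piltant Rem 3.2 fourfold Z^p +
u₄u₁^p + u₃u₂^p is, on the dual side, the ADDITIVE derivation
D = u₁∂_(v₃) − u₂∂_(v₄) on k[u₁,u₂,v₃,v₄] (linear, Jordan type (2,2), singular along the invariant
plane u₁ = u₂ = 0); ONE blow-up of that plane
makes the saturated transform non-singular in both charts (u₂ = u₁w: D = u₁(∂_(v₃) − w∂_(v₄))),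
matching the known one-blow-up resolution. The
informative falsifier (a kit afternoon for the critic): translate Hauser–Perlega's divergent family
z^(p^e) + F on A⁵ (arXiv:1802.05010 §4) and the
α_p-quotient fourfolds of arXiv:2501.01179 / arXiv:2603.07152 to derivations on the regular
Frobenius top and follow the valuation of a divergent run:
does an additive point recur with the same (ord D, Jordan type, ord λ)? A recurrence refutes the
proposed counter (not yet FolLU); a recurrence with
provably no regular invariant exit refutes FolLU.

NUMBERS. Known ranges: FolLU dim 2 all p (arXiv:2405.05735 Thm 1, functorial Thm 4; p = 2 dim ≤ 3
with schematic regular ambient, Thm 3); rank one dim 3: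
multiplicative up to μ_p-quotient ambient points (arXiv:2311.16694 Thm 7); char 0 line foliations:
dim 3 (CRS 2014 valuative; MP13 with DM stacks),
open dim ≥ 4. P¹(F_p) dynamics of multiplicative surface points under point blow-ups (card,
re-verified by two refuters): absorbed for p = 2, 3; cycles
2→3→2 (p = 5), 5→4→3→2→5 (p = 7) — multiplicative points are terminal for smooth centres from p = 5
on, hence MUST be handed to LogCanQuotLU. Items at
open: 8 (6 cruxes, 1 target, 1 assembly); shared: 4.

DEFINITION REQUESTS. None needed to state the items (Mathlib: Derivation, ValuationSubring,
Subalgebra.FG, IsFractionRing, IsRegularLocalRing, Localization.AtPrime;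
p-closedness and the local ring at the centre are spelled out elementwise). Nice-to-have Literature
notions for provers (not filed now): OneFoliation
(saturated p-closed sub-p-Lie-algebra of Der), MultiplicativePoint / AdditivePoint of a p-closed
derivation on a regular local ring.

Novelty: Searches (2026-08-16): `lit search --source arxiv` ×12 (Posva ×2 found: 2405.05735, 2311.16694;
2503.00926; nothing on 'p-closed vector field local
uniformization valuation', 'purely inseparable descent local uniformization derivation', 'quotients
by vector fields characteristic p ring of constants');
`lit search --source crossref` ×5 (doi:10.1007/s13398-013-0117-7 CRS14, doi:10.4310/jdg/1376053448
MP13, doi:10.1070/im1976v010n06abeh001833 RS76,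
doi:10.1090/pspum/046.2/927978 Ekedahl87, doi:10.2307/2373435 Seidenberg68, doi:10.1007/bf01472134
Aramova–Avramov86); `lit search --source zbmath --reviews`
×2; `lit galaxy search --star all` ×4 ('p-closed derivation': 2 books — Shafarevich Collected
Papers, Miyanishi–Ito; 0 pdf/web); `lit galaxy search
--in-book 269560737431601` ×3 + `lit galaxy read` (Miyanishi–Ito §1.8.2 read); `lit vsearch` ×1
(generic); `lit frontier ResolutionOfSingularities --since
2022` (30 rows, none on foliations; noted arXiv:2602.06553 ranking functions), `lit bridges --cross
any`; local `lit search` tier unavailable (searchd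
resets, logged). Ledger: all 22 route headers read; 90 card titles; cards
alpha-p-to-mu-p-foliation-reduction, mu-p-fixed-locus-universality,
tropical-schoen-certificates read in full; `ledger negatives` (0).
Nearest prior art found: Posva arXiv:2405.05735 / arXiv:2311.16694 (resolution of 1-foliations in
dim ≤ 3, DEDUCED from Giraud/Cossart normal forms;
rank one in dim 3 only with μ_p-quotient ambient points; global, over algebraica  [refs: 10.1007/s13398-013-0117-7, 10.4310/jdg/1376053448, 10.1070/im1976v010n06abeh001833, 10.1090/pspum/046.2/927978, 10.2307/2373435, 10.1007/bf01472134, 2602.06553, 2405.05735, 2311.16694, 0804.1554, doi:10.1007/s13398-013-0117-7, doi:10.4310/jdg/1376053448, doi:10.1070/im1976v010n06abeh001833, doi:10.1090/pspum/046.2/927978, doi:10.2307/2373435, doi:10.1007/bf01472134]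

Barriers (technique_class: foliation-reduction, jacobson-duality, valuative): - technique_class: foliation-reduction, jacobson-duality, valuative
- Literature.Barriers.ResolutionOfSingularities.DimensionFourFrontier: NOT evaded as a state of
knowledge (FolLU is open from dim 3, the summit from dim 4; PatchingRelPerfect is the frontier's
missing fourth step, shared with six routes). Evaded in mechanism: no embedded resolution one
dimension down, no normal form of a hypersurface along a valuation; the object is a derivation on a
REGULAR local ring with a linear-algebra counter; the bet is that rank-one p-closed derivations in
dim n are more rigid than hypersurfaces of multiplicity p in dim n.
- Literature.Barriers.ResolutionOfSingularities.Hauser2003_kangarooShadeIncrease: the shade/residual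
order of the EQUATION z^p + F is not tracked; cleaning F ↦ F + G^p does not change the dual
foliation, so the kangaroo's trigger (re-cleaning after translation) has no counterpart; honest:
whether (Jordan type, ord λ) can jump is exactly the cheapest falsifier.
- Literature.Barriers.ResolutionOfSingularities.KangarooShadeIncreaseNarrow: same for the narrow
form, and for Hauser–Perlega's residual-order barrier (ResidualOrderUnbounded file):
Hauser–Perlega's unbounded residual order lives at height e ≥ 3 on the equation side; the route
works at height one (degree-p steps) on the derivation side; it does not claim immunity, it names
the translation of HP's family as the test.
- Literature.Barriers.ResolutionOfSingularities.Narasimhan1983_noSmoothHypersurfaceThroughTopLo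

History (route lifecycle, newest last):
- 2026-08-25T06:25:20Z · DORMANT — reconciler: no traction for 7.5 d (last activity item-evidence-added at 2026-08-17T19:03:53Z); parked, not closed — `ledger route dormant route-ResolutionOfSing (operator:999:1344528)
- 2026-08-26T17:01:17Z · REACTIVATED — reconciler: reactivated — activity statement-claimed at 2026-08-26T16:25:04Z after parking at 2026-08-25T06:25:20Z (operator:999:3539271)

sub-problem: ResolutionOfSingularities · status: open · opened planner-plan-novel-ResolutionOfSingularities-Re-dc19aa3a-b-v2-g9-0 2026-08-16T22:24:58Z · rev 1 · ledger route-ResolutionOfSingularities-FoliationDescent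
GENERATED by the gate from the ledger (D-0016/17). Provers cite these decls: `theorem foo : Summit.ResolutionOfSingularities.ResolutionOfSingularities.Theses.FoliationDescent.<Decl> := …` in Summits/ResolutionOfSingularities/ResolutionOfSingularities/Theorems/<Name>.lean.
-/

namespace Summit.ResolutionOfSingularities.ResolutionOfSingularities.Theses.FoliationDescent

open scoped BigOperators Topology Manifold Classical MeasureTheory ProbabilityTheory Matrix InnerProductSpace ComplexConjugate ContinuousMap
open Filter Set Function TopologicalSpace MeasureTheory

attribute [summit_statement] _root_.ResolutionOfSingularities

/-- item stmt-ResolutionOfSingularities-16158 · target · rank 0 · open · by planner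
why it might fail: it is Temkin2013 Rem 1.3.5's residual problem, open in dim ≥ 4 for every p (CutkoskyMourtada2019 §1); fails iff LU fails over some perfect field.
sources: Temkin2013, arXiv:0804.1554, CutkoskyMourtada2019, Literature.Barriers.ResolutionOfSingularities.DimensionFourFrontier
[target] local uniformization of α_p-torsors over bases regular at the centre, over PERFECT ground
fields: k perfect of char p, K/k, O a valuation ring of K, A₀ ⊆ O f.g. regular at the centre, t ∈ K
with t^p ∈ A₀ and Frac(A₀[t]) = K ⇒ some f.g. A with A₀[t] ⊆ A ⊆ O, Frac A = K, A regular at the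
centre (Valuative's LuAlphaPTorsor, stmt-0641, with [PerfectField k] added). Derived in `closes` as
WinToTorsorLU applied to ShadowGameWin. -/
@[route_item "route-ResolutionOfSingularities-FoliationDescent"]
def TorsorLUPerfect : Prop :=
  ∀ p : ℕ, p.Prime → ∀ (k K : Type) [Field k] [CharP k p] [PerfectField k] [Field K] [Algebra k K] (O : ValuationSubring K) (A₀ : Subalgebra k K) (h₀ : A₀.toSubring ≤ O.toSubring) (t : K), A₀.FG → t ^ p ∈ A₀ → IsFractionRing (Algebra.adjoin k (insert t (A₀ : Set K))) K → IsRegularLocalRing (Localization.AtPrime (Ideal.comap (Subring.inclusion h₀) (IsLocalRing.maximalIdeal O))) → ∃ (A : Subalgebra k K) (h : A.toSubring ≤ O.toSubring), A₀ ≤ A ∧ t ∈ A ∧ A.FG ∧ IsFractionRing A K ∧ IsRegularLocalRing (Localization.AtPrime (Ideal.comap (Subring.inclusion h) (IsLocalRing.maximalIdeal O)))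

/-- item stmt-ResolutionOfSingularities-17081 · crux · rank 2 · open · by planner
why it might fail: known only in dim 2 (Posva 2405.05735 Thm 1; RS76); rank one in dim 3 char p needs μ_p-quotient ambient points in print (2311.16694 Thm 7); char-0 analogue open in dim ≥ 4; an additive point reproducing its (ord D, Jordan type, ord λ) along a valuation kills the counter.
sources: arXiv:2405.05735, arXiv:2311.16694, doi:10.1070/im1976v010n06abeh001833, doi:10.1007/s13398-013-0117-7, doi:10.4310/jdg/1376053448, arXiv:2503.00926
[crux] FOLIATION LOCAL UNIFORMIZATION (card alpha-p-to-mu-p B1-loc, typed): k perfect of char p, O a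
valuation ring of K ⊇ k, S ≤ O a f.g. k-subalgebra with Frac S = K, regular at the centre, D a
nonzero k-derivation of K with D^p = c·D (rank-one 1-foliation). Then some f.g. S' with S ≤ S' ≤ O,
Frac S' = K, REGULAR at the centre, and some g ≠ 0 such that g•D maps the local ring S'_c into
itself and is there NON-SINGULAR (∃ x ∈ S'_c with (g•D)x a unit) or MULTIPLICATIVE (∃ unit u of S'_c
with (g•D)^p = u·(g•D)). Expected mechanism: blow up regular D-invariant centres inside Sing(D)
along O; counter = (ord D, Jordan type of the nilpotent linear part, ord λ); additive →
multiplicative by Hochschild's formula for λ under u·π^*D. [difficulty: open-problem] -/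
@[route_item "route-ResolutionOfSingularities-FoliationDescent", crux]
def FolLU : Prop :=
  ∀ p : ℕ, p.Prime → ∀ (k K : Type) [Field k] [CharP k p] [PerfectField k] [Field K] [Algebra k K] (O : ValuationSubring K) (S : Subalgebra k K) (hS : S.toSubring ≤ O.toSubring) (D : Derivation k K K), S.FG → IsFractionRing S K → IsRegularLocalRing (Localization.AtPrime (Ideal.comap (Subring.inclusion hS) (IsLocalRing.maximalIdeal O))) → D ≠ 0 → (∃ c : K, ∀ x : K, (⇑D)^[p] x = c * D x) → ∃ (S' : Subalgebra k K) (h' : S'.toSubring ≤ O.toSubring) (g : K), S ≤ S' ∧ S'.FG ∧ IsFractionRing S' K ∧ IsRegularLocalRing (Localization.AtPrime (Ideal.comap (Subring.inclusion h') (IsLocalRing.maximalIdeal O))) ∧ g ≠ 0 ∧ (∀ x : K, (∃ a b : K, a ∈ S' ∧ b ∈ S' ∧ b ≠ 0 ∧ b⁻¹ ∈ O ∧ x = a / b) → ∃ a b : K, a ∈ S' ∧ b ∈ S' ∧ b ≠ 0 ∧ b⁻¹ ∈ O ∧ (g • D) x = a / b) ∧ ((∃ x : K, (∃ a b : K, a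 ∈ S' ∧ b ∈ S' ∧ b ≠ 0 ∧ b⁻¹ ∈ O ∧ x = a / b) ∧ (g • D) x ≠ 0 ∧ ((g • D) x)⁻¹ ∈ O) ∨ (∃ u : K, (∃ a b : K, a ∈ S' ∧ b ∈ S' ∧ b ≠ 0 ∧ b⁻¹ ∈ O ∧ u = a / b) ∧ u ≠ 0 ∧ u⁻¹ ∈ O ∧ ∀ x : K, (⇑(g • D))^[p] x = u * (g • D) x))

/-- item stmt-ResolutionOfSingularities-17082 · crux · rank 3 · open · by planner
why it might fail: the multiplicative normal form is printed at CLOSED points over algebraically closed k (formal coordinates); at non-closed centres / perfect non-closed k one needs a Zariski-local (étale-descended) toric uniformization of the constants and control of constants under henselization.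
sources: arXiv:2311.16694, doi:10.1070/im1976v010n06abeh001833, doi:10.1007/bf01472134, isbn:9789811215209, arXiv:1412.7941
[crux] LOG-CANONICAL QUOTIENTS UNIFORMIZE (card alpha-p-to-mu-p B2, valuative): in the output
situation of FolLU (S' regular at the centre, g•D preserving S'_c, non-singular or multiplicative, D
≠ 0 p-closed) and for every f.g. R ≤ S' of D-constants, there is a f.g. k-subalgebra A ≤ O of
constants (D = 0 on A) with R ≤ A, Frac A = K^D and A regular at the centre. Non-singular case: A :=
S' ∩ K^D works (finite over k[S'^p]; (S' ∩ K^D)_c = (S'_c)^D; rescale to ∂x = 1, ∂^p = 0, Taylor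
projection S'_c = ⊕_(i<p) (S'_c)^D x^i, faithfully flat descent of regularity — RS76 Thm 1 /
Aramova–Avramov / Miyanishi–Ito §1.8.2 Lemma (4)). Multiplicative case: (S'_c)^D is étale-locally
the μ_p-quotient k'[[x]]^(Σλ_i x_i ∂_i) (Rudakov–Shafarevich normal form; Posva 2311.16694 Prop
11–12/Thm 7), a diagonalizable-group quotient, hence toric and uniformizable by a toric local
blow-up inside K^D. [deps: FolLU] [difficulty: L] -/
@[route_item "route-ResolutionOfSingularities-FoliationDescent", crux]
def LogCanQuotLU : Prop :=
  ∀ p : ℕ, p.Prime → ∀ (k K : Type) [Field k] [CharP k p] [PerfectField k] [Field K] [Algebra k K] (O : ValuationSubring K) (S' : Subalgebra k K) (h' : S'.toSubring ≤ O.toSubring) (D : Derivation k K K) (g : K) (R : Subalgebra k K), S'.FG → IsFractionRing S' K → IsRegularLocalRing (Localization.AtPrime (Ideal.comap (Subring.inclusion h') (IsLocalRing.maximalIdeal O))) → D ≠ 0 → (∃ c : K, ∀ x : K, (⇑D)^[p] x = c * D x) → g ≠ 0 → (∀ x : K, (∃ a b : K, a ∈ S' ∧ b ∈ S' ∧ b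 ≠ 0 ∧ b⁻¹ ∈ O ∧ x = a / b) → ∃ a b : K, a ∈ S' ∧ b ∈ S' ∧ b ≠ 0 ∧ b⁻¹ ∈ O ∧ (g • D) x = a / b) → ((∃ x : K, (∃ a b : K, a ∈ S' ∧ b ∈ S' ∧ b ≠ 0 ∧ b⁻¹ ∈ O ∧ x = a / b) ∧ (g • D) x ≠ 0 ∧ ((g • D) x)⁻¹ ∈ O) ∨ (∃ u : K, (∃ a b : K, a ∈ S' ∧ b ∈ S' ∧ b ≠ 0 ∧ b⁻¹ ∈ O ∧ u = a / b) ∧ u ≠ 0 ∧ u⁻¹ ∈ O ∧ ∀ x : K, (⇑(g • D))^[p] x = u * (g • D) x)) → R.FG → R ≤ S' → (∀ x ∈ R, D x = 0) → ∃ (A : Subalgebra k K) (hA : A.toSubring ≤ O.toSubring), R ≤ A ∧ A.FG ∧ (∀ x ∈ A, D x = 0) ∧ (∀ x : K, D x = 0 → ∃ a b : K, a ∈ A ∧ b ∈ A ∧ b ≠ 0 ∧ x = a / b) ∧ IsRegularLocalRing (Localization.AtPrime (Ideal.comap (Subring.inclusion hA) (IsLocalRing.maximalIdeal O)))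

/-- item stmt-ResolutionOfSingularities-17083 · crux · rank 4 · closed · proved by Summit.ResolutionOfSingularities.ResolutionOfSingularities.Theorems.DualSandwich.Birth.DualSandwich_proof @ 77585398e676 (prover) · by planner
why it might fail: elementary but unformalized: k perfect (A₀^(1/p) f.g.), degree-p chains in a finite purely inseparable extension, transport of valuation rings/centres through Frobenius and inclusions; a 'regular at the centre' mismatch between O' on S and O on A₀ would force a restatement.
sources: Temkin2013, arXiv:0804.1554, doi:10.1090/pspum/046.2/927978, isbn:9789811215209
[crux] THE DOUBLE SANDWICH (consumed reduction, per the whole statements): FolLU → LogCanQuotLU →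
TorsorLUPerfect. Given A₀ ≤ O regular at the centre over PERFECT k, t^p = a ∈ A₀, K = K₀(t): put K'
:= K₀^(1/p) ⊇ K with the unique extension O' of O, S := A₀^(1/p) (≅ A₀ by Frobenius; finitely
generated over k BECAUSE k is perfect; regular at the centre of O'), R := A₀[t] ⊆ S ∩ K; [K' : K] =
p^(n−1); choose a maximal chain K = F₀ ⊂ F₁ ⊂ … ⊂ F_(n−1) = K' of degree-p steps; each F_(i+1)/F_i
is the kernel extension of a p-closed derivation d/dz (z^p ∈ F_i), so FolLU then LogCanQuotLU (same
R, valuation ring O' ∩ F_i) produce a regular f.g. model of F_i containing R from one of F_(i+1);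
after n−1 steps A ⊇ A₀[t] in O, Frac A = K, regular at the centre. (The converse, 0641 ⇒ the bare
descent step, is the usual upward sandwich: recorded in the header, not an item.) [deps: FolLU,
LogCanQuotLU] [difficulty: M] -/
@[route_item "route-ResolutionOfSingularities-FoliationDescent", crux]
def DualSandwich : Prop :=
  FolLU → LogCanQuotLU → TorsorLUPerfect

-- `DualSandwich` holds: proved by `Summit.ResolutionOfSingularities.ResolutionOfSingularities.Theorems.DualSandwich.Birth.DualSandwich_proof` @ 77585398e676 (its module imports this route file, so no `_holds` link can be stated here).

/-- item stmt-ResolutionOfSingularities-16162 · crux · rank 5 · open · by planner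
why it might fail: rests on Temkin2013 Thm 1.3.2 (vendored fact with an unproved leaf in tree: Temkin2013RelativeCurveSmoothFibre) and on Temkin's model dominating the GIVEN R; smooth ≠ regular bookkeeping at each tower step.
sources: Temkin2013, arXiv:0804.1554, Literature.AlgebraicGeometry.Resolution.Temkin2013Relative, Literature.Barriers.ResolutionOfSingularities.InseparableBaseChange
[crux] Temkin's inseparable reduction over PERFECT ground fields: for every prime p, LU of
α_p-torsors over bases regular at the centre (TorsorLUPerfect at p) implies relative LU for every
f.g. K/k, k perfect of char p (Temkin2013 Thm 1.3.2: after a finite purely inseparable L/K an affine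
model is uniformized with smooth centre; Frobenius F^n moves it into K (k perfect, so k^{p^n} = k
and the transport is finite); the tower K₀ ⊂ … ⊂ K of degree-p radical steps is climbed by the
torsor crux). Valuative's TorsorToLurel (stmt-10968) is the all-k version. [difficulty: L] -/
@[route_item "route-ResolutionOfSingularities-FoliationDescent", crux]
def TorsorToLurelPerfect : Prop :=
  ∀ p : ℕ, p.Prime → (∀ (k K : Type) [Field k] [CharP k p] [PerfectField k] [Field K] [Algebra k K] (O : ValuationSubring K) (A₀ : Subalgebra k K) (h₀ : A₀.toSubring ≤ O.toSubring) (t : K), A₀.FG → t ^ p ∈ A₀ → IsFractionRing (Algebra.adjoin k (insert t (A₀ : Set K))) K → IsRegularLocalRing (Localization.AtPrime (Ideal.comap (Subring.inclusion h₀) (IsLocalRing.maximalIdeal O))) → ∃ (A : Subalgebra k K) (h : A.toSubring ≤ O.toSubring), A₀ ≤ A ∧ t ∈ A ∧ A.FG ∧ IsFractionRing A K ∧ IsRegularLocalRing (Localization.AtPrime (Ideal.comap (Subring.inclusion h) (IsLocalRing.maximalIdeal O)))) → ∀ (k K : Type) [Field k] [CharP k p] [PerfectField k] [Field K] [Algebra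 k K], (⊤ : IntermediateField k K).FG → ∀ O : ValuationSubring K, (∀ c : k, algebraMap k K c ∈ O) → ∀ R : Subalgebra k K, R.FG → R.toSubring ≤ O.toSubring → ∃ (A : Subalgebra k K) (h : A.toSubring ≤ O.toSubring), R ≤ A ∧ A.FG ∧ IsFractionRing A K ∧ IsRegularLocalRing (Localization.AtPrime (Ideal.comap (Subring.inclusion h) (IsLocalRing.maximalIdeal O)))

/-- item stmt-ResolutionOfSingularities-16161 · crux · rank 6 · open · by planner
why it might fail: patching LUs into one proper regular model is known only in dim ≤ 3 (Zariski; CossartPiltant2008 Prop 4.9 / Piltant2013); in dim ≥ 4 no reduction Res ⇐ LU exists even in char 0 (CutkoskyMourtada2019 p.3); plain relative LU may be too weak an input.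
sources: CutkoskyMourtada2019, Temkin2013, CossartPiltant2019, NovacoskiSpivakovsky2014, Literature.Barriers.ResolutionOfSingularities.DimensionFourFrontier
[crux] Zariski patching over PERFECT ground fields: for every prime p, relative local uniformization
(every f.g. R ⊆ O is dominated by a f.g. A ⊆ O with Frac A = K, regular at the centre) for all f.g.
K/k with k perfect of char p implies that every reduced separated scheme of finite type over every
perfect field of char p has a resolution. Fibrewise identical to Valuative's PatchingRel (stmt-0642)
restricted to perfect k — one patching argument proves both. [difficulty: open-problem] -/
@[route_item "route-ResolutionOfSingularities-FoliationDescent", crux]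
def PatchingRelPerfect : Prop :=
  ∀ p : ℕ, p.Prime → (∀ (k K : Type) [Field k] [CharP k p] [PerfectField k] [Field K] [Algebra k K], (⊤ : IntermediateField k K).FG → ∀ O : ValuationSubring K, (∀ c : k, algebraMap k K c ∈ O) → ∀ R : Subalgebra k K, R.FG → R.toSubring ≤ O.toSubring → ∃ (A : Subalgebra k K) (h : A.toSubring ≤ O.toSubring), R ≤ A ∧ A.FG ∧ IsFractionRing A K ∧ IsRegularLocalRing (Localization.AtPrime (Ideal.comap (Subring.inclusion h) (IsLocalRing.maximalIdeal O)))) → ∀ (k : Type) [Field k] [CharP k p] [PerfectField k] (X : AlgebraicGeometry.Scheme.{0}) (f : X ⟶ AlgebraicGeometry.Spec (.of k)), AlgebraicGeometry.IsSeparated f → AlgebraicGeometry.LocallyOfFiniteType f → AlgebraicGeometry.QuasiCompact f → AlgebraicGeometry.IsReduced X → Literature.AlgebraicGeometry.Resolution.Scheme.HasResolution X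

/-- item stmt-ResolutionOfSingularities-0549 · crux · rank 7 · open · by planner
why it might fail: only known mechanism spreads X over a f.g. field of definition and base-changes a resolution over a perfect subfield back; regular is not geometrically regular under inseparable extension (EGA IV 6.7.4), e.g. k = F_p((t)).
sources: arXiv:math/0703678, Kollar2007, Literature.Barriers.ResolutionOfSingularities.InseparableBaseChange, Literature.Barriers.ResolutionOfSingularities.RegularNotGeometricallyRegular
PerfectToAll: for a prime p, resolution of all reduced separated finite-type schemes over all
PERFECT fields of char p implies ResolutionInChar p (all fields of char p). Expected inputs:
Neron-Popescu (Stacks 07GC), spreading out, openness of regular locus on excellent schemes;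
regularity is not stable under inseparable ground field extension, which is the difficulty. -/
@[route_item "route-ResolutionOfSingularities-FoliationDescent", crux]
def DescentPerfectToAll : Prop :=
  ∀ p : ℕ, p.Prime → (∀ (k : Type) [Field k] [CharP k p] [PerfectField k] (X : AlgebraicGeometry.Scheme.{0}) (f : X ⟶ AlgebraicGeometry.Spec (.of k)), AlgebraicGeometry.IsSeparated f → AlgebraicGeometry.LocallyOfFiniteType f → AlgebraicGeometry.QuasiCompact f → AlgebraicGeometry.IsReduced X → Literature.AlgebraicGeometry.Resolution.Scheme.HasResolution X) → Literature.AlgebraicGeometry.Resolution.ResolutionInChar.{0} p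

/-- item stmt-ResolutionOfSingularities-17084 · assembly · rank 1 · open · by planner
sources: Temkin2013, NovacoskiSpivakovsky2014, arXiv:2405.05735
[assembly] FolLU → LogCanQuotLU → DualSandwich → TorsorToLurelPerfect → PatchingRelPerfect →
DescentPerfectToAll → ResolutionOfSingularities. -/
@[route_item "route-ResolutionOfSingularities-FoliationDescent"]
def Assembly : Prop :=
  FolLU → LogCanQuotLU → DualSandwich → TorsorToLurelPerfect → PatchingRelPerfect → DescentPerfectToAll → _root_.ResolutionOfSingularities

/-! D-0027 §2.1 — DECIDING THEOREM (planner-authored via `route open/edit --closes-file`; by planner-plan-novel-ResolutionOfSingularities-Re-dc19aa3a-b-v 2026-08-16T22:24:58Z):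
its hypotheses are this route's items and its conclusion the sub-problem Statement (glue_lint), and it elaborates with this file. -/

@[closes "route-ResolutionOfSingularities-FoliationDescent"] theorem closes (hF : FolLU) (hQ : LogCanQuotLU) (hR : DualSandwich) (hT : TorsorToLurelPerfect)
    (hP : PatchingRelPerfect) (hD : DescentPerfectToAll) : _root_.ResolutionOfSingularities :=
  fun p hp => hD p hp (hP p hp (hT p hp ((hR hF hQ) p hp)))

end Summit.ResolutionOfSingularities.ResolutionOfSingularities.Theses.FoliationDescent
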